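import Mathlib
import Literature.MathematicalPhysics.QuantumLattice.FermiRG.Salmhofer1998WickReorderingProof
import Literature.MathematicalPhysics.QuantumLattice.FermiRG.Salmhofer1998NormBoundProof
import HarnessLib

/-!
# Salmhofer 1998, §3.2–§4.1: from the RGE at order `λ^r` to the component RGE `\icomRGE` in F7b's typed form
# (`IsRGESolution`) — the bridge (4.2) ⇒ (4.3) and the sign/weight dictionary, PROVED

Theorem-only companion (kind `proof`: no definition, no named fact, no `instance`, no `notation`, no `sorry`) of the
DEFINITION-FROZEN typer files of the cell `gate-hubbard-kl` (statements-first wave D-0069 (2)):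
F7b `Salmhofer1998Sec2.lean` (`kappaSum`, `MIndex`, `covMatrix`, `gInt`, `quadTerm` = (4.3), `antisym` = `𝔸_m`,
`IsRGESolution` = `\icomRGE`; Theorems 1–2 `TruncatedPowerCounting` / `ManyFermionGreenFunctionBound`, both PROVED by t5 over
an ABSTRACT `KernelFamily`), F7af `GrassmannWickOrderedRGE.lean` ((3.12)–(3.17): `wickKernel`, (3.15)
`hasDerivAt_wickKernel_of_add`), F7aj `Salmhofer1998WickReordering.lean` (`detDeriv` = (4.2), `pairKernel`, `wickReorderKernel`,
`wickReorderSign`) and its discharge `Salmhofer1998WickReorderingProof.lean` (F-078: `wickReorderingFormula_wickReorderSign`,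
(3.20) `wickKernel_bilinear_eq_antisym_wickReorderKernel`, and the Appendix-B lemmas `sum_detDeriv_covMatrix_mul`,
`kernel_contr'`, `antisymm_snoc`, `argA_comp_perm`, `argB_comp_perm` reused below); t5's `Salmhofer1998NormBoundProof.lean`
supplies the argument builders `argL`/`argR`/`splitL`/`splitR` and `summand` (`quadTerm = ∫dκ summand`, `rfl`).

Source: M. Salmhofer, *Continuous renormalization for fermions and Fermi liquid theory*, Commun. Math. Phys. **194** (1998)
249–295, arXiv:cond-mat/9706188 [Salmhofer1998]; locators `render pNNNN:Ln` = chunk `pNNNN.txt` line `n` of the materialised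
arXiv TeX (`lit read arxiv:cond-mat/9706188`; cell render HOME/dag/texts/paper-arxiv-cond-mat_9706188), NOT printed pages;
the render strips equation numbers, so the displays of §3 are cited by TeX label / line range ((3.?) `\icomRGE` =
p0012:L152–L160, "comparison of the coefficients" = p0012:L108–L114, `𝔸_m` = p0012:L116–L122), those of §4.1 by the numerals
F7b/F7aj already use ((4.2) = p0014:L17–L32, (4.3) = p0014:L44–L52).

## What is proved

1. **(4.2) ⇒ (4.3)** (`pairKernel_succ_eq_sq_mul`, render p0014:L17–L52): for totally antisymmetric coefficient functions,
   F7aj's Proposition-2 term `Σ_{V,W∈Γ^i} ∂_t det𝒟^{(i)}(V,W) G¹(X₁,V) G²(W̃,X₂)` (unsigned `detDeriv`) EQUALS (4.3)'s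
   `i² Σ_{V,W∈Γ} Ḋ(V,W) Σ_{Y,Z∈Γ^{i-1}} det𝒟^{(i-1)}(Y,Z) G¹(X₁,Y,V) G²(W,Z̃,X₂)` — "expanding along each differentiated column
   … the sign is cancelled by rearranging `G(X₁,V) = (-1)^{i-l} G(X₁,V^{(l)},V_l)`, `G(W̃,X₂) = (-1)^{i-l'} G(W_{l'},W̃^{(l')},X₂)`
   … the summand becomes independent of `l` and `l'`, so the sum gives a factor `i²`" (p0014 L33–L43).  The legs land EXACTLY
   in F7b's argument builders (`argL_succ_eq_snoc`, `argR_succ_eq_cons`): this certifies F7b's typing of the leg placement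
   `G_{m₁r₁}(t|X₁,Y,V) G_{m₂r₂}(t|W,Z̃,X₂)` in `quadTerm` by the kernel (until now only eyeballed by the referees).
2. **The dictionary** (`quadTerm_eq_neg_wickReorderKernel`): for a totally antisymmetric family `G` and weights `ε ≠ 0`
   (print `∫_Γ dX = ε_Γ Σ_X`, p0011 L8–L13; F7b `gInt`), `quadTerm ε m̄ D Ḋ G G m r t = -ε^{-m} · wickReorderKernel σ m̄ (-D_t)
   (-Ḋ_t) ((-ε^{m'} G_{m'r'}(t))_{r',m'}) m r` with `σ = wickReorderSign`, `σ(i) = (-1)^{i-1}`, the sign of Proposition 2 that the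
   kernel certified in the tree's conventions (F-078 discharge, flag S-t7g12-1).  Mechanism: the `i`-term of (4.3) is of degree
   `i - 1` in `D` (`det𝒟^{(i-1)}`), one in `Ḋ`, one in each `G`, so `(D, Ḋ, G) ↦ (-D, -Ḋ, -G)` multiplies it by `(-1)^{i-1}` and
   flips the left side of `\icomRGE`; the weights contribute `ε^{2i} ε^{-m₁} ε^{-m₂} = ε^{-m}` on `𝓜` (`m₁ + m₂ = m + 2i`).
   This is the consumer note (ii) of the F-078 landing (cell STATUS 2026-08-27T11:52:36Z) as a theorem.
3. **`isRGESolution_of_orderwise_rge`** — Salmhofer's §3.2 end to end for the FINITE algebra: let `t ↦ C_t` be an entrywise `C¹`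
   flow with derivative `Ċ_t`, `C_∞` a matrix with every `C_∞ - C_t` antisymmetric (print: "`C_t` antisymmetric … continuously
   differentiable in `t`", p0011 L23–L33; `D_t = C - C_t`, `Ċ_t = -Ḋ_t`, p0011 L159–L161), and `(𝒢_r(t))_{r≥1}` even elements
   with `∂_t 𝒢_r = Δ_{Ċ_t} 𝒢_r + ½ Σ_{r₁=1}^{r-1} (δ𝒢_{r₁}/δψ, Ċ_t δ𝒢_{r-r₁}/δψ)_Γ` coefficientwise (= (RGE) p0011 L88–L93 at order
   `λ^r` of the expansion `𝒢 = Σ_r λ^r 𝒢_r`, p0011 L146–L148, with `𝒬_r` of p0012 L48–L54; F7x `HasCoeffDerivAt`, the shape of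
   `hasCoeffDerivAt_salmhofer_rge`) and Wick degrees `≤ m̄(r)` w.r.t. `C_∞ - C_t`.  Then the `∫dX`-weighted Wick coefficients
   `G_{m,r}(t|X) := -ε^{-m} · wickKernel_{C_∞-C_t}(𝒢_r(t))_m(X)` (= `-weightedKernel ε (e^{Δ_{C_∞-C_t}} 𝒢_r(t)) m X` of
   `GrassmannKernels.lean`) satisfy **`IsRGESolution ε m̄ (C - C_∞) Ċ G`** — F7b's `\icomRGE` for the consistent pair
   `(D, Ḋ) = (C_t - C_∞, Ċ_t)` (`hasDerivAt_sub_const_apply`: `Ḋ = ∂_t D`, the link F7b's Theorems 1–2 assume).  Proof as printed: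
   (3.15) "the term linear in `𝒢` drops out by Wick ordering" (F7af `hasDerivAt_wickKernel_of_add`), (3.20) "comparison of the
   coefficients" (F-078 discharge; extended here to all degrees `m`, `wickKernel_bilinear_eq_antisym_wickReorderKernel'` — above
   `|Γ|` every string repeats a leg and both sides vanish), items 1–2, and `∫_0^t` (p0012 L152–L158; continuity of the right side,
   `continuous_quadTerm`, and the fundamental theorem of calculus).  `isRGESolution_of_orderwise_rge_neg` is the same statement
   in the sign convention of the tree's `effAction` (`𝒱_r = -𝒢_r`: `∂_t𝒱_r = Δ𝒱_r - ½Σ(δ𝒱,Ċδ𝒱)`, coefficients `+ε^{-m}·wickKernel`;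
   print's initial condition `G_{mr}(0|X) = -δ_{r1}V_m(X)`, p0012 L160–L162, is this orientation).

So the tree's PROVED Theorems 1–2 of Salmhofer 1998 (t5: `TruncatedPowerCounting_holds`, `ManyFermionGreenFunctionBound_holds`),
typed over an abstract `KernelFamily` subject to `IsRGESolution`/`IsTruncatedRGESolution`, now attach to every order-by-order
solution of the RGE in a finite Grassmann algebra: the remaining hypotheses of Theorem 2 are properties of the pair
`(C_t - C_∞, Ċ_t)` ((4.6) `DForm`, `D_t = 0` beyond `log βε₀`, the `L¹` and `L¹–L^∞` bounds — all insensitive to the signs above).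

## What is NOT proved here (hypotheses `hflow`, `hdeg`)

That the `λ^r`-coefficients of the effective action `𝒢(t,ψ) = log ∫dμ_{C_t}(χ) e^{λV(χ+ψ)}` ((3.3), p0011 L46–L60: "a well-defined
formal power series in `λ` … `e^{𝒢}` is a polynomial in `λ`") satisfy the order-by-order system — print: insert (3.?)
`𝒢 = Σ λ^r 𝒢_r` into (RGE) and compare coefficients — and Lemma 3 (ih1) (the degree bound `m̄(r) = 2r + 2` propagates along the
flow, p0018 L146).  F7x proves (RGE) for the full effective action at each numerical `λ` (`hasCoeffDerivAt_salmhofer_rge`); the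
coefficientwise-in-`λ` version wants the effective action over formal-power-series scalars and is left to a separate companion.
Nothing here is a statement about the Hubbard model; no sorry; axioms = the standard three.
-/

noncomputable section

namespace Literature.MathematicalPhysics.QuantumLattice.FermiRG

namespace Salmhofer1998

open GrassmannAlgebra Finset

/-! ## §1 (4.2) ⇒ (4.3): Laplace expansion of `∂_t det` against antisymmetric coefficient functions -/

section DetExpansion

variable {Γ : Type*} [Fintype Γ]

/-- Reindexing a sum over strings by a permutation of the positions. [folklore] -/
private theorem sum_comp_perm_arg' {M : Type*} [AddCommMonoid M] {n : ℕ} (σ : Equiv.Perm (Fin n))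
    (f : (Fin n → Γ) → M) : ∑ V : Fin n → Γ, f (V ∘ σ) = ∑ V : Fin n → Γ, f V :=
  Fintype.sum_bijective (fun V : Fin n → Γ => V ∘ σ)
    (Function.bijective_iff_has_inverse.2
      ⟨fun Z => Z ∘ σ.symm, fun V => by funext k; simp, fun Z => by funext k; simp⟩) _ _ fun _ => rfl

/-- **The determinant against an antisymmetric function** ("writes out the determinant as
`det 𝒟^{(i)}(V,W) = Σ_π sgn π ∏_k D(V_k, W_{π(k)})`", render p0012:L139-L145, summed against a function antisymmetric in
`W`): `Σ_W det 𝒟_D^{(n)}(V,W) Ψ(W) = n! Σ_W ∏_k D(V_k,W_k) Ψ(W)`.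
[cite: Salmhofer1998, §3.3 (render p0012:L139-L150); §4.1 (4.3) (render p0014:L42-L52)] -/
theorem sum_det_covMatrix_mul_of_antisymm {n : ℕ} (D : Matrix Γ Γ ℂ) (V : Fin n → Γ) (Ψ : (Fin n → Γ) → ℂ)
    (hΨ : ∀ (σ : Equiv.Perm (Fin n)) (W : Fin n → Γ), Ψ (W ∘ σ) = ((Equiv.Perm.sign σ : ℤ) : ℂ) * Ψ W) :
    ∑ W : Fin n → Γ, (covMatrix D V W).det * Ψ W =
      ((Nat.factorial n : ℕ) : ℂ) * ∑ W : Fin n → Γ, (∏ k, D (V k) (W k)) * Ψ W := by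
  have hsgn : ∀ σ : Equiv.Perm (Fin n),
      ((Equiv.Perm.sign σ : ℤ) : ℂ) * ((Equiv.Perm.sign σ : ℤ) : ℂ) = 1 := by
    intro σ
    rw [← Int.cast_mul, ← Units.val_mul, Int.units_mul_self, Units.val_one, Int.cast_one]
  calc ∑ W : Fin n → Γ, (covMatrix D V W).det * Ψ W
      = ∑ W : Fin n → Γ, ∑ σ : Equiv.Perm (Fin n),
          ((Equiv.Perm.sign σ : ℤ) : ℂ) * ((∏ k, D (V k) ((W ∘ σ) k)) * Ψ W) := by
        refine Finset.sum_congr rfl fun W _ => ?_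
        rw [← Matrix.det_transpose, Matrix.det_apply', Finset.sum_mul]
        refine Finset.sum_congr rfl fun σ _ => ?_
        simp only [Matrix.transpose_apply, covMatrix, Matrix.of_apply, Function.comp_apply]
        ring
    _ = ∑ σ : Equiv.Perm (Fin n), ((Equiv.Perm.sign σ : ℤ) : ℂ) *
          ∑ W : Fin n → Γ, (∏ k, D (V k) ((W ∘ σ) k)) * Ψ W := by
        rw [Finset.sum_comm]
        simp only [Finset.mul_sum]
    _ = ∑ σ : Equiv.Perm (Fin n), ((Equiv.Perm.sign σ : ℤ) : ℂ) *
          ∑ W : Fin n → Γ, (∏ k, D (V k) (W k)) * Ψ (W ∘ ⇑(σ⁻¹)) := by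
        refine Finset.sum_congr rfl fun σ _ => ?_
        congr 1
        rw [← sum_comp_perm_arg' σ⁻¹ (fun W : Fin n → Γ => (∏ k, D (V k) ((W ∘ σ) k)) * Ψ W)]
        refine Finset.sum_congr rfl fun W _ => ?_
        simp only [Function.comp_apply, Equiv.Perm.coe_inv, Equiv.symm_apply_apply]
    _ = ∑ σ : Equiv.Perm (Fin n), ∑ W : Fin n → Γ, (∏ k, D (V k) (W k)) * Ψ W := by
        refine Finset.sum_congr rfl fun σ _ => ?_
        rw [Finset.mul_sum]
        refine Finset.sum_congr rfl fun W _ => ?_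
        rw [hΨ σ⁻¹ W, Equiv.Perm.sign_inv, ← mul_assoc, ← mul_assoc, mul_right_comm _ _ (((Equiv.Perm.sign σ : ℤ)) : ℂ),
          hsgn, one_mul]
    _ = ((Nat.factorial n : ℕ) : ℂ) * ∑ W : Fin n → Γ, (∏ k, D (V k) (W k)) * Ψ W := by
        rw [Finset.sum_const, Finset.card_univ, Fintype.card_perm, Fintype.card_fin, nsmul_eq_mul]

omit [Fintype Γ] in
/-- Prepending a fixed leg commutes with permuting the others: `Fin.cons y (T ∘ σ) = Fin.cons y T ∘ σ⁺`,
`σ⁺ = decomposeFin⁻¹(0, σ)` (fixes `0`, acts by `σ` on the successors; same sign). [folklore] -/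
private theorem cons_comp_decomposeFin {n : ℕ} (y : Γ) (T : Fin n → Γ) (σ : Equiv.Perm (Fin n)) :
    (Fin.cons y T : Fin (n + 1) → Γ) ∘ (Equiv.Perm.decomposeFin.symm (0, σ)) = Fin.cons y (T ∘ σ) := by
  funext i
  refine Fin.cases ?_ (fun k => ?_) i
  · rw [Function.comp_apply, Equiv.Perm.decomposeFin_symm_apply_zero, Fin.cons_zero, Fin.cons_zero]
  · rw [Function.comp_apply, Equiv.Perm.decomposeFin_symm_apply_succ, Equiv.swap_self, Equiv.refl_apply,
      Fin.cons_succ, Fin.cons_succ, Function.comp_apply]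

/-- **(4.2) ⇒ (4.3), the combinatorial core** (render p0014:L17-L52): the `(m₁, m₂, i) = (p+1, q+1, n+1)` term of
Proposition 2 — `Σ_{V,W ∈ Γ^{i}} ∂_t det𝒟^{(i)}(V,W) G¹(X₁,V) G²(W̃,X₂)` (F7aj `pairKernel`, unsigned) — equals, for
`G¹`, `G²` totally antisymmetric, `i² Σ_{V,W ∈ Γ} Ḋ(V,W) Σ_{Y,Z ∈ Γ^{i-1}} det𝒟^{(i-1)}(Y,Z) G¹(X₁,Y,V) G²(W,Z̃,X₂)`:
"expanding along each differentiated column gives (4.2) … the sign is cancelled by rearranging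
`G(X₁,V) = (-1)^{i-l} G(X₁,V^{(l)},V_l)`, `G(W̃,X₂) = (-1)^{i-l'} G(W_{l'},W̃^{(l')},X₂)` … upon renaming of the integration
variables the summand becomes independent of `l` and `l'`, so the sum gives a factor `i²`" (p0014 L33-L43).  Here: the
determinant collapse of Appendix B (`sum_detDeriv_covMatrix_mul`, `kernel_contr'` of the F-078 discharge) puts the
`Ḋ`-line on the last `V`-leg / first `W`-leg, `antisymm_snoc` moves `V_l` to the end of `G¹`'s legs, and
`sum_det_covMatrix_mul_of_antisymm` re-assembles `det𝒟^{(i-1)}` on the remaining lines.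
[cite: Salmhofer1998, §4.1 (4.2)-(4.3) (render p0014:L17-L52); Proposition 2 (render p0012:L69-L106)] -/
theorem pairKernel_succ_eq_sq_mul (D E : Matrix Γ Γ ℂ) {p q n m : ℕ} (h : n ≤ p ∧ n ≤ q ∧ p + q = m + 2 * n)
    (G₁ G₂ : (k : ℕ) → (Fin k → Γ) → ℂ)
    (hG₁ : ∀ (σ : Equiv.Perm (Fin (p + 1))) (Y : Fin (p + 1) → Γ),
      G₁ (p + 1) (Y ∘ σ) = ((Equiv.Perm.sign σ : ℤ) : ℂ) * G₁ (p + 1) Y)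
    (hG₂ : ∀ (σ : Equiv.Perm (Fin (q + 1))) (Y : Fin (q + 1) → Γ),
      G₂ (q + 1) (Y ∘ σ) = ((Equiv.Perm.sign σ : ℤ) : ℂ) * G₂ (q + 1) Y) (X : Fin m → Γ) :
    pairKernel D E G₁ G₂ m (p + 1) (q + 1) (n + 1) X =
      (((n : ℂ) + 1) ^ 2) * ∑ x : Γ, ∑ y : Γ, E x y *
        ∑ V : Fin (n + 1 - 1) → Γ, ∑ W : Fin (n + 1 - 1) → Γ, (covMatrix D V W).det *
          (G₁ (p + 1) (Fin.snoc (fun j : Fin p => if hj : (j : ℕ) < p - n then X ⟨j, by omega⟩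
              else V ⟨j - (p - n), by omega⟩) x) *
            G₂ (q + 1) (Fin.cons y (fun j : Fin q => if hj : (j : ℕ) < n then W ⟨n - 1 - j, by omega⟩
              else X ⟨p - n + (j - n), by omega⟩))) := by
  -- (the internal strings are typed `Fin (n + 1 - 1) → Γ`, the shape in which F7b's `quadTerm` produces them at
  -- `i = n + 1`; definitionally `Fin n → Γ`)
  show _ = (((n : ℂ) + 1) ^ 2) * ∑ x : Γ, ∑ y : Γ, E x y *
        ∑ V : Fin n → Γ, ∑ W : Fin n → Γ, (covMatrix D V W).det *
          (G₁ (p + 1) (Fin.snoc (fun j : Fin p => if hj : (j : ℕ) < p - n then X ⟨j, by omega⟩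
              else V ⟨j - (p - n), by omega⟩) x) *
            G₂ (q + 1) (Fin.cons y (fun j : Fin q => if hj : (j : ℕ) < n then W ⟨n - 1 - j, by omega⟩
              else X ⟨p - n + (j - n), by omega⟩)))
  -- Steps 1–2 (Laplace expansion + renaming; = the F-078 discharge's `hpk`): the `E`-line sits on the legs that are
  -- PREPENDED to both argument strings
  have hpk : pairKernel D E G₁ G₂ m (p + 1) (q + 1) (n + 1) X =
      (((n + 1) * Nat.factorial (n + 1) : ℕ) : ℂ) * (((-1 : ℂ) ^ p) *
        ∑ x : Γ, ∑ y : Γ, E x y * (∑ V : Fin n → Γ, ∑ W : Fin n → Γ, (∏ k, D (V k) (W k)) *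
          ((fun Y : Fin p → Γ => G₁ (p + 1) (Fin.cons x Y))
              (fun j : Fin p => if hj : (j : ℕ) < p - n then X ⟨j, by omega⟩ else V ⟨j - (p - n), by omega⟩) *
            (fun Y : Fin q → Γ => G₂ (q + 1) (Fin.cons y Y))
              (fun j : Fin q => if hj : (j : ℕ) < n then W ⟨n - 1 - j, by omega⟩
                else X ⟨p - n + (j - n), by omega⟩)))) := by
    rw [pairKernel_of D E G₁ G₂ (by omega) X, ← kernel_contr' D E h hG₁ (G₂ (q + 1)) X]
    have hassoc : ∀ (V W : Fin (n + 1) → Γ), detDeriv (covMatrix D V W) (covMatrix E V W) *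
        G₁ (p + 1) (fun j : Fin (p + 1) => if hj : (j : ℕ) < p + 1 - (n + 1) then X ⟨j, by omega⟩
          else V ⟨j - (p + 1 - (n + 1)), by omega⟩) *
        G₂ (q + 1) (fun j : Fin (q + 1) => if hj : (j : ℕ) < n + 1 then W ⟨n + 1 - 1 - j, by omega⟩
          else X ⟨p + 1 - (n + 1) + (j - (n + 1)), by omega⟩) =
        detDeriv (covMatrix D V W) (covMatrix E V W) *
        (G₁ (p + 1) (fun j : Fin (p + 1) => if hj : (j : ℕ) < p + 1 - (n + 1) then X ⟨j, by omega⟩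
          else V ⟨j - (p + 1 - (n + 1)), by omega⟩) *
          G₂ (q + 1) (fun j : Fin (q + 1) => if hj : (j : ℕ) < n + 1 then W ⟨n + 1 - 1 - j, by omega⟩
            else X ⟨p + 1 - (n + 1) + (j - (n + 1)), by omega⟩)) :=
      fun V W => mul_assoc _ _ _
    simp only [hassoc]
    refine sum_detDeriv_covMatrix_mul D E
      (fun V W => G₁ (p + 1) (fun j : Fin (p + 1) => if hj : (j : ℕ) < p + 1 - (n + 1) then X ⟨j, by omega⟩
          else V ⟨j - (p + 1 - (n + 1)), by omega⟩) *
        G₂ (q + 1) (fun j : Fin (q + 1) => if hj : (j : ℕ) < n + 1 then W ⟨n + 1 - 1 - j, by omega⟩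
          else X ⟨p + 1 - (n + 1) + (j - (n + 1)), by omega⟩))
      (fun σ V W => ?_) (fun σ V W => ?_)
    · obtain ⟨σ', hs, heq⟩ := argA_comp_perm (P := p + 1) (n := n + 1) (by omega) (by omega) X V σ
      rw [heq, hG₁, hs, mul_assoc]
    · obtain ⟨σ', hs, heq⟩ := argB_comp_perm (P := p + 1) (Q := q + 1) (n := n + 1) (m := m) (by omega) X W σ
      rw [heq, hG₂, hs, mul_left_comm]
  rw [hpk]
  -- Step 4: on the right, re-assemble `det 𝒟^{(n)}` from the diagonal product against the antisymmetric `W`-block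
  have hΨ : ∀ (x y : Γ) (V : Fin n → Γ),
      ∑ W : Fin n → Γ, (covMatrix D V W).det *
          (G₁ (p + 1) (Fin.snoc (fun j : Fin p => if hj : (j : ℕ) < p - n then X ⟨j, by omega⟩
              else V ⟨j - (p - n), by omega⟩) x) *
            G₂ (q + 1) (Fin.cons y (fun j : Fin q => if hj : (j : ℕ) < n then W ⟨n - 1 - j, by omega⟩
              else X ⟨p - n + (j - n), by omega⟩))) =
        ((Nat.factorial n : ℕ) : ℂ) * ∑ W : Fin n → Γ, (∏ k, D (V k) (W k)) *
          (G₁ (p + 1) (Fin.snoc (fun j : Fin p => if hj : (j : ℕ) < p - n then X ⟨j, by omega⟩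
              else V ⟨j - (p - n), by omega⟩) x) *
            G₂ (q + 1) (Fin.cons y (fun j : Fin q => if hj : (j : ℕ) < n then W ⟨n - 1 - j, by omega⟩
              else X ⟨p - n + (j - n), by omega⟩))) := by
    intro x y V
    refine sum_det_covMatrix_mul_of_antisymm D V _ fun σ W => ?_
    obtain ⟨σ', hs, heq⟩ := argB_comp_perm (P := p) (Q := q) (n := n) (m := m) h X W σ
    rw [heq, ← cons_comp_decomposeFin y _ σ', hG₂, Equiv.Perm.decomposeFin.symm_sign, if_pos rfl, one_mul, hs]
    ring
  simp_rw [hΨ]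
  -- Step 3: on the right, move the `E`-leg of `G¹` from the end to the front (`antisymm_snoc`)
  simp_rw [antisymm_snoc hG₁]
  -- Step 5: constants `(n+1)·(n+1)! = (n+1)²·n!`
  rw [Nat.factorial_succ]
  push_cast
  simp only [Finset.mul_sum]
  refine Finset.sum_congr rfl fun x _ => Finset.sum_congr rfl fun y _ => Finset.sum_congr rfl fun V _ =>
    Finset.sum_congr rfl fun W _ => ?_
  ring

end DetExpansion

/-! ## §2 The dictionary: F7b's `quadTerm` ((4.3), weights `ε`) versus F7aj's `wickReorderKernel` (Proposition 2) -/

section Dictionary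

variable {Γ : Type*} [Fintype Γ]

/-- A sum over two-leg strings is a double sum. [folklore] -/
private theorem sum_fin_two_arrow {M : Type*} [AddCommMonoid M] (f : (Fin 2 → Γ) → M) :
    ∑ VW : Fin 2 → Γ, f VW = ∑ v : Γ, ∑ w : Γ, f ![v, w] := by
  rw [← Fintype.sum_prod_type']
  refine Fintype.sum_equiv (finTwoArrowEquiv Γ) _ _ (fun VW => ?_)
  congr 1
  funext j
  fin_cases j <;> simp [finTwoArrowEquiv]

/-- `∫dκ_{mr}` only reads its integrand on the index set `𝓜`. [cite: Salmhofer1998, Proposition 2 (render p0012:L81-L98)] -/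
theorem kappaSum_congr_of_MIndex (mbar : ℕ → ℕ) (m r : ℕ) {F G : ℕ → ℕ → ℕ → ℕ → ℕ → ℂ}
    (h : ∀ r₁ m₁ m₂ i, MIndex mbar r₁ (r - r₁) m m₁ m₂ i = true → F r₁ m₁ (r - r₁) m₂ i = G r₁ m₁ (r - r₁) m₂ i) :
    kappaSum mbar m r F = kappaSum mbar m r G := by
  unfold kappaSum
  refine Finset.sum_congr rfl fun r₁ _ => Finset.sum_congr rfl fun m₁ _ => Finset.sum_congr rfl fun m₂ _ =>
    Finset.sum_congr rfl fun i _ => ?_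
  by_cases hM : MIndex mbar r₁ (r - r₁) m m₁ m₂ i = true
  · rw [if_pos hM, if_pos hM, h _ _ _ _ hM]
  · rw [if_neg hM, if_neg hM]

/-- `∫dκ_{mr}` is linear. [cite: Salmhofer1998, Proposition 2 (render p0012:L81-L95)] -/
theorem kappaSum_const_mul (mbar : ℕ → ℕ) (m r : ℕ) (c : ℂ) (F : ℕ → ℕ → ℕ → ℕ → ℕ → ℂ) :
    kappaSum mbar m r (fun r₁ m₁ r₂ m₂ i => c * F r₁ m₁ r₂ m₂ i) = c * kappaSum mbar m r F := by
  unfold kappaSum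
  simp only [Finset.mul_sum]
  refine Finset.sum_congr rfl fun r₁ _ => Finset.sum_congr rfl fun m₁ _ => Finset.sum_congr rfl fun m₂ _ =>
    Finset.sum_congr rfl fun i _ => ?_
  split_ifs <;> ring

omit [Fintype Γ] in
/-- The argument string `(X₁, Y, V)` of (4.3) (F7b / `argL`) is the string `(X₁, V)` of Proposition 2 with the last internal
leg split off. [cite: Salmhofer1998, §4.1 (render p0014:L33-L43)] -/
theorem argL_succ_eq_snoc {p q n m : ℕ} (h : n ≤ p ∧ n ≤ q ∧ p + q = m + 2 * n)
    (hs : p + 1 - (n + 1) + (q + 1 - (n + 1)) = m) (X : Fin m → Γ) (Y : Fin (n + 1 - 1) → Γ) (v : Γ) :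
    argL (p + 1) (n + 1) (splitL hs X) Y v =
      Fin.snoc (fun j : Fin p => if hj : (j : ℕ) < p - n then X ⟨j, by omega⟩ else Y ⟨j - (p - n), by omega⟩) v := by
  funext j
  refine Fin.lastCases ?_ (fun j' => ?_) j
  · rw [Fin.snoc_last]
    simp only [argL, Fin.val_last]
    rw [dif_neg (by omega), dif_neg (by omega)]
  · rw [Fin.snoc_castSucc]
    simp only [argL, splitL, Fin.val_castSucc]
    by_cases hj : (j' : ℕ) < p - n
    · rw [dif_pos (by omega), dif_pos hj]
    · rw [dif_neg (by omega), dif_neg hj, dif_pos (by omega)]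
      exact congrArg Y (Fin.ext (by dsimp only; omega))

omit [Fintype Γ] in
/-- The argument string `(W, Z̃, X₂)` of (4.3) (F7b / `argR`) is the string `(W̃, X₂)` of Proposition 2 with the first
internal leg split off. [cite: Salmhofer1998, §4.1 (render p0014:L33-L43)] -/
theorem argR_succ_eq_cons {p q n m : ℕ} (h : n ≤ p ∧ n ≤ q ∧ p + q = m + 2 * n)
    (hs : p + 1 - (n + 1) + (q + 1 - (n + 1)) = m) (X : Fin m → Γ) (w : Γ) (Z : Fin (n + 1 - 1) → Γ) :
    argR (q + 1) (n + 1) w Z (splitR hs X) =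
      Fin.cons w (fun j : Fin q => if hj : (j : ℕ) < n then Z ⟨n - 1 - j, by omega⟩ else X ⟨p - n + (j - n), by omega⟩) := by
  funext j
  refine Fin.cases ?_ (fun j' => ?_) j
  · rw [Fin.cons_zero]
    simp [argR]
  · rw [Fin.cons_succ]
    simp only [argR, splitR, Fin.val_succ]
    rw [dif_neg (by omega)]
    by_cases hj : (j' : ℕ) < n
    · rw [dif_pos (by omega), dif_pos hj]
      exact congrArg Z (Fin.ext (by dsimp only; omega))
    · rw [dif_neg (by omega), dif_neg hj]
      exact congrArg X (Fin.ext (by dsimp only; omega))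

/-- F7b's `(r₁, m₁, r₂, m₂, i) = (r₁, p+1, r₂, q+1, n+1)` summand of `quadTerm` (t5's `summand`, definitionally the term of (4.3)),
with the `∫dX = ε Σ_X` weights collected: `i² ε^{2i} Σ_{V,W} Ḋ(V,W) Σ_{Y,Z} det𝒟^{(i-1)}(Y,Z) G(X₁,Y,V) G(W,Z̃,X₂)`.
[cite: Salmhofer1998, §4.1 (4.3) (render p0014:L44-L52); §3 `∫_Γ dX = ε_Γ Σ_X` (render p0011:L8-L13)] -/
theorem summand_succ_eq (ε : ℝ) (D Ddot : ℝ → Γ → Γ → ℂ) (G₁ G₂ : KernelFamily Γ) (t : ℝ)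
    (r₁ r₂ : ℕ) {p q n m : ℕ} (h : n ≤ p ∧ n ≤ q ∧ p + q = m + 2 * n) (X : Fin m → Γ) :
    summand ε D Ddot G₁ G₂ t r₁ (p + 1) r₂ (q + 1) (n + 1) m X =
      (((n : ℂ) + 1) ^ 2) * ((((ε ^ 2 * (ε ^ n * ε ^ n) : ℝ)) : ℂ) *
        ∑ v : Γ, ∑ w : Γ, Ddot t v w * ∑ Y : Fin (n + 1 - 1) → Γ, ∑ Z : Fin (n + 1 - 1) → Γ,
          (covMatrix (D t) Y Z).det *
            (G₁ (p + 1) r₁ t (Fin.snoc (fun j : Fin p => if hj : (j : ℕ) < p - n then X ⟨j, by omega⟩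
                else Y ⟨j - (p - n), by omega⟩) v) *
              G₂ (q + 1) r₂ t (Fin.cons w (fun j : Fin q => if hj : (j : ℕ) < n then Z ⟨n - 1 - j, by omega⟩
                else X ⟨p - n + (j - n), by omega⟩)))) := by
  have hs : p + 1 - (n + 1) + (q + 1 - (n + 1)) = m := by omega
  rw [summand, dif_pos ⟨by omega, by omega, by omega⟩]
  simp only [argL_succ_eq_snoc h hs, argR_succ_eq_cons h hs, gInt, sum_fin_two_arrow, Matrix.cons_val_zero,
    Matrix.cons_val_one, Nat.add_sub_cancel, Finset.mul_sum]
  push_cast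
  refine Finset.sum_congr rfl fun v _ => Finset.sum_congr rfl fun w _ => Finset.sum_congr rfl fun Y _ =>
    Finset.sum_congr rfl fun Z _ => ?_
  ring

omit [Fintype Γ] in
/-- `𝒟_{-D} = -𝒟_D`. [cite: Salmhofer1998, Proposition 2 (render p0012:L104-L106)] -/
theorem covMatrix_neg (D : Γ → Γ → ℂ) {i : ℕ} (V W : Fin i → Γ) : covMatrix (-D) V W = -covMatrix D V W := by
  ext k l
  simp [covMatrix]

/-- **The dictionary, one index at a time.**  On `𝓜` (so `i, m₁, m₂ ≥ 1`, `m₁ + m₂ = m + 2i`), for a totally antisymmetric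
family `G`: F7b's weighted (4.3)-summand equals `-ε^{-m} σ(i) ×` F7aj's Proposition-2 term `pairKernel` evaluated at the
NEGATED covariance pair `(-D, -Ḋ)` and the family `-ε^{m'} G_{m'}` — the kernel-certified sign `σ(i) = (-1)^{i-1}` of
Proposition 2 in the tree's conventions (F-078 discharge) against the "`+∂_t det` for every `i`" of (4.3) that `quadTerm`
encodes: `(D, Ḋ, G) ↦ (-D, -Ḋ, -G)` multiplies the `i`-term (degree `i-1` in `D`, one `Ḋ`, two `G`'s) by `(-1)^i`.
[cite: Salmhofer1998, §4.1 (4.2)-(4.3) (render p0014:L17-L52); Proposition 2 (render p0012:L69-L106)] -/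
theorem summand_eq_neg_wickReorder_term {ε : ℝ} (hε : ε ≠ 0) (D Ddot : ℝ → Γ → Γ → ℂ) (G : KernelFamily Γ)
    (hG : ∀ (k r : ℕ) (t : ℝ) (σ : Equiv.Perm (Fin k)) (Y : Fin k → Γ),
      G k r t (Y ∘ σ) = ((Equiv.Perm.sign σ : ℤ) : ℂ) * G k r t Y)
    (t : ℝ) {r₁ r₂ m₁ m₂ i m : ℕ} (hi : 1 ≤ i) (hm₁ : 1 ≤ m₁) (hm₂ : 1 ≤ m₂) (hsum : m₁ + m₂ = m + 2 * i)
    (X : Fin m → Γ) :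
    summand ε D Ddot G G t r₁ m₁ r₂ m₂ i m X =
      -((ε⁻¹ ^ m : ℝ) : ℂ) * (((wickReorderSign i : ℤ) : ℂ) *
        pairKernel (-(D t)) (-(Ddot t)) (fun k Y => -((ε ^ k : ℝ) : ℂ) * G k r₁ t Y)
          (fun k Y => -((ε ^ k : ℝ) : ℂ) * G k r₂ t Y) m m₁ m₂ i X) := by
  obtain ⟨n, rfl⟩ : ∃ n, i = n + 1 := ⟨i - 1, by omega⟩
  obtain ⟨p, rfl⟩ : ∃ p, m₁ = p + 1 := ⟨m₁ - 1, by omega⟩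
  obtain ⟨q, rfl⟩ : ∃ q, m₂ = q + 1 := ⟨m₂ - 1, by omega⟩
  by_cases hc : n ≤ p ∧ n ≤ q
  · have h' : n ≤ p ∧ n ≤ q ∧ p + q = m + 2 * n := ⟨hc.1, hc.2, by omega⟩
    have hG₁ : ∀ (σ : Equiv.Perm (Fin (p + 1))) (Y : Fin (p + 1) → Γ),
        (fun k Y => -((ε ^ k : ℝ) : ℂ) * G k r₁ t Y) (p + 1) (Y ∘ σ) =
          ((Equiv.Perm.sign σ : ℤ) : ℂ) * (fun k Y => -((ε ^ k : ℝ) : ℂ) * G k r₁ t Y) (p + 1) Y := by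
      intro σ Y; simp only [hG]; ring
    have hG₂ : ∀ (σ : Equiv.Perm (Fin (q + 1))) (Y : Fin (q + 1) → Γ),
        (fun k Y => -((ε ^ k : ℝ) : ℂ) * G k r₂ t Y) (q + 1) (Y ∘ σ) =
          ((Equiv.Perm.sign σ : ℤ) : ℂ) * (fun k Y => -((ε ^ k : ℝ) : ℂ) * G k r₂ t Y) (q + 1) Y := by
      intro σ Y; simp only [hG]; ring
    rw [summand_succ_eq ε D Ddot G G t r₁ r₂ h' X, pairKernel_succ_eq_sq_mul (-(D t)) (-(Ddot t)) h' _ _ hG₁ hG₂ X]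
    simp only [covMatrix_neg, Matrix.det_neg, Fintype.card_fin, Pi.neg_apply, wickReorderSign, Nat.add_sub_cancel,
      Finset.mul_sum]
    push_cast
    refine Finset.sum_congr rfl fun v _ => Finset.sum_congr rfl fun w _ => Finset.sum_congr rfl fun Y _ =>
      Finset.sum_congr rfl fun Z _ => ?_
    have hpow : (ε : ℂ) ^ (p + 1) * (ε : ℂ) ^ (q + 1) = (ε : ℂ) ^ m * ((ε : ℂ) ^ 2 * ((ε : ℂ) ^ n * (ε : ℂ) ^ n)) := by
      rw [← pow_add, ← pow_add, ← pow_add, ← pow_add]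
      congr 1
      omega
    have hinv : ((ε : ℂ)⁻¹) ^ m * (ε : ℂ) ^ m = 1 := by
      rw [← mul_pow, inv_mul_cancel₀ (Complex.ofReal_ne_zero.2 hε), one_pow]
    have hsq : ((-1 : ℂ) ^ n) * ((-1 : ℂ) ^ n) = 1 := by
      rw [← pow_add, ← two_mul, pow_mul, neg_one_sq, one_pow]
    have key : ((ε : ℂ)⁻¹) ^ m * ((ε : ℂ) ^ (p + 1) * (ε : ℂ) ^ (q + 1)) =
        (ε : ℂ) ^ 2 * ((ε : ℂ) ^ n * (ε : ℂ) ^ n) := by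
      rw [hpow, ← mul_assoc, hinv, one_mul]
    linear_combination
      (-(((n : ℂ) + 1) ^ 2) * Ddot t v w * (covMatrix (D t) Y Z).det *
          G (p + 1) r₁ t (Fin.snoc (fun j : Fin p => if hj : (j : ℕ) < p - n then X ⟨j, by omega⟩
            else Y ⟨j - (p - n), by omega⟩) v) *
          G (q + 1) r₂ t (Fin.cons w (fun j : Fin q => if hj : (j : ℕ) < n then Z ⟨n - 1 - j, by omega⟩
            else X ⟨p - n + (j - n), by omega⟩)) * ((-1 : ℂ) ^ n * (-1 : ℂ) ^ n)) * key +
      (-(((n : ℂ) + 1) ^ 2) * Ddot t v w * (covMatrix (D t) Y Z).det *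
          G (p + 1) r₁ t (Fin.snoc (fun j : Fin p => if hj : (j : ℕ) < p - n then X ⟨j, by omega⟩
            else Y ⟨j - (p - n), by omega⟩) v) *
          G (q + 1) r₂ t (Fin.cons w (fun j : Fin q => if hj : (j : ℕ) < n then Z ⟨n - 1 - j, by omega⟩
            else X ⟨p - n + (j - n), by omega⟩)) * ((ε : ℂ) ^ 2 * ((ε : ℂ) ^ n * (ε : ℂ) ^ n))) * hsq
  · rw [summand, dif_neg (by omega), pairKernel_of_not _ _ _ _ (by omega) X, mul_zero, mul_zero]

/-- **The dictionary `(4.3) ↔ Proposition 2`**: for a totally antisymmetric coefficient family `G` and weights `ε ≠ 0`,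
F7b's bilinear term `quadTerm ε m̄ D Ḋ G G` (typed from (4.3), `+∂_t det` for every `i`, `∫dX = ε Σ_X`) is
`-ε^{-m} · Q^{σ}_{m,r}[-D, -Ḋ; (-ε^{m'} G_{m'})_{m'}]` with `Q^σ` F7aj's `wickReorderKernel` at the kernel-certified sign
`σ = wickReorderSign` (the F-078 discharge `wickReorderingFormula_wickReorderSign`).
[cite: Salmhofer1998, §4.1 (4.2)-(4.3) (render p0014:L17-L52); Proposition 2 (render p0012:L69-L106)] -/
theorem quadTerm_eq_neg_wickReorderKernel {ε : ℝ} (hε : ε ≠ 0) (mbar : ℕ → ℕ) (D Ddot : ℝ → Γ → Γ → ℂ)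
    (G : KernelFamily Γ)
    (hG : ∀ (k r : ℕ) (t : ℝ) (σ : Equiv.Perm (Fin k)) (Y : Fin k → Γ),
      G k r t (Y ∘ σ) = ((Equiv.Perm.sign σ : ℤ) : ℂ) * G k r t Y)
    (m r : ℕ) (t : ℝ) (X : Fin m → Γ) :
    quadTerm ε mbar D Ddot G G m r t X =
      -((ε⁻¹ ^ m : ℝ) : ℂ) * wickReorderKernel wickReorderSign mbar (-(D t)) (-(Ddot t))
        (fun r' k Y => -((ε ^ k : ℝ) : ℂ) * G k r' t Y) m r X := by
  rw [quadTerm_eq_kappaSum_summand, wickReorderKernel, ← kappaSum_const_mul]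
  refine kappaSum_congr_of_MIndex mbar m r fun r₁ m₁ m₂ i hM => ?_
  obtain ⟨hi, hm₁, -, hm₂, -, hsum, -, -⟩ := (MIndex_eq_true_iff mbar r₁ (r - r₁) m m₁ m₂ i).1 hM
  exact summand_eq_neg_wickReorder_term hε D Ddot G hG t hi hm₁ hm₂ hsum X

end Dictionary

/-! ## §3 Continuity of the bilinear term along a continuous flow -/

section Continuity

variable {Γ : Type*} [Fintype Γ]

/-- The (4.3) bilinear term is continuous in `t` when `D_t`, `Ḋ_t` and the two coefficient families are (a finite sum of
products). [cite: Salmhofer1998, §4.1 (4.3) (render p0014:L44-L52); §3.1 "`C_t` continuously differentiable in `t`" (render p0011:L32-L33)] -/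
theorem continuous_quadTerm (ε : ℝ) (mbar : ℕ → ℕ) {D Ddot : ℝ → Γ → Γ → ℂ} {G₁ G₂ : KernelFamily Γ}
    (hD : ∀ X Y : Γ, Continuous fun t => D t X Y) (hDdot : ∀ X Y : Γ, Continuous fun t => Ddot t X Y)
    (hG₁ : ∀ (k r : ℕ) (Y : Fin k → Γ), Continuous fun t => G₁ k r t Y)
    (hG₂ : ∀ (k r : ℕ) (Y : Fin k → Γ), Continuous fun t => G₂ k r t Y) (m r : ℕ) (X : Fin m → Γ) :
    Continuous fun t => quadTerm ε mbar D Ddot G₁ G₂ m r t X := by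
  simp only [quadTerm_eq_kappaSum_summand, kappaSum]
  refine continuous_finsetSum _ fun r₁ _ => continuous_finsetSum _ fun m₁ _ =>
    continuous_finsetSum _ fun m₂ _ => continuous_finsetSum _ fun i _ => ?_
  split_ifs
  · refine continuous_const.mul ?_
    unfold summand
    split_ifs
    · refine continuous_const.mul ?_
      unfold gInt
      refine continuous_const.mul (continuous_finsetSum _ fun VW _ => ?_)
      refine (hDdot _ _).mul (continuous_const.mul (continuous_finsetSum _ fun Y _ =>
        continuous_const.mul (continuous_finsetSum _ fun Z _ => ?_)))
      refine ((Continuous.matrix_det ?_).mul (hG₁ _ _ _)).mul (hG₂ _ _ _)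
      exact continuous_pi fun k => continuous_pi fun l => hD _ _
    · exact continuous_const
  · exact continuous_const

end Continuity

/-! ## §4 From the RGE at order `λ^r` to F7b's `IsRGESolution` -/

section Flow

variable {Γ : Type} [LinearOrder Γ] [Fintype Γ]

omit [LinearOrder Γ] [Fintype Γ] in
/-- `𝔸_m` is antisymmetric: `(𝔸_m f)(X ∘ σ) = sgn σ · (𝔸_m f)(X)`. [cite: Salmhofer1998, §3.2 `𝔸_m` (render p0012:L116-L122)] -/
theorem antisym_comp_perm {m : ℕ} (f : (Fin m → Γ) → ℂ) (X : Fin m → Γ) (σ : Equiv.Perm (Fin m)) :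
    antisym f (X ∘ σ) = ((Equiv.Perm.sign σ : ℤ) : ℂ) * antisym f X := by
  have hsgn : ((Equiv.Perm.sign σ : ℤ) : ℂ) * ((Equiv.Perm.sign σ : ℤ) : ℂ) = 1 := by
    rw [← Int.cast_mul, ← Units.val_mul, Int.units_mul_self, Units.val_one, Int.cast_one]
  unfold antisym
  simp only [Complex.real_smul]
  rw [mul_left_comm]
  congr 1
  rw [Finset.mul_sum]
  refine Fintype.sum_equiv (Equiv.mulLeft σ) _ _ (fun π => ?_)
  rw [Equiv.coe_mulLeft, Equiv.Perm.sign_mul, Units.val_mul, Int.cast_mul, Equiv.Perm.coe_mul,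
    ← Function.comp_assoc]
  linear_combination (-(((Equiv.Perm.sign π : ℤ) : ℂ) * f ((X ∘ ⇑σ) ∘ ⇑π))) * hsgn

omit [LinearOrder Γ] [Fintype Γ] in
/-- `𝔸_m f` vanishes at strings with a repeated leg. [cite: Salmhofer1998, §3.2 `𝔸_m` (render p0012:L116-L122)] -/
theorem antisym_eq_zero_of_not_injective {m : ℕ} (f : (Fin m → Γ) → ℂ) {X : Fin m → Γ}
    (hX : ¬Function.Injective X) : antisym f X = 0 := by
  obtain ⟨a, b, hab, hne⟩ : ∃ a b, X a = X b ∧ a ≠ b := by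
    unfold Function.Injective at hX
    push Not at hX
    exact hX
  have hfix : X ∘ Equiv.swap a b = X := by
    funext k
    simp only [Function.comp_apply]
    rcases eq_or_ne k a with rfl | hka
    · rw [Equiv.swap_apply_left, hab]
    · rcases eq_or_ne k b with rfl | hkb
      · rw [Equiv.swap_apply_right, hab]
      · rw [Equiv.swap_apply_of_ne_of_ne hka hkb]
  have h := antisym_comp_perm f X (Equiv.swap a b)
  rw [hfix, Equiv.Perm.sign_swap hne, Units.val_neg, Units.val_one, Int.cast_neg, Int.cast_one, neg_one_mul] at h
  exact self_eq_neg.mp h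

omit [LinearOrder Γ] [Fintype Γ] in
/-- `𝔸_m` is linear. [cite: Salmhofer1998, §3.2 `𝔸_m` (render p0012:L116-L122)] -/
theorem antisym_const_mul {m : ℕ} (c : ℂ) (f : (Fin m → Γ) → ℂ) (X : Fin m → Γ) :
    antisym (fun Y => c * f Y) X = c * antisym f X := by
  unfold antisym
  simp only [Complex.real_smul, Finset.mul_sum]
  refine Finset.sum_congr rfl fun π _ => ?_
  ring

omit [LinearOrder Γ] [Fintype Γ] in
/-- `𝔸_m` commutes with `∫_0^t ds` (finite sum). [cite: Salmhofer1998, §3.3 `\icomRGE` (render p0012:L152-L160)] -/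
theorem integral_antisym {m : ℕ} (q : ℝ → (Fin m → Γ) → ℂ) (hq : ∀ Y, Continuous fun s => q s Y)
    (X : Fin m → Γ) (a b : ℝ) :
    ∫ s in a..b, antisym (q s) X = antisym (fun Y => ∫ s in a..b, q s Y) X := by
  simp only [antisym, Complex.real_smul]
  rw [intervalIntegral.integral_const_mul, intervalIntegral.integral_finsetSum (fun π _ => ?_)]
  · congr 1
    refine Finset.sum_congr rfl fun π _ => ?_
    exact intervalIntegral.integral_const_mul _ _
  · exact (continuous_const.mul (hq _)).intervalIntegrable _ _

omit [LinearOrder Γ] [Fintype Γ] in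
/-- `𝔸_m` of a continuous family is continuous. [cite: Salmhofer1998, §3.2 `𝔸_m` (render p0012:L116-L122)] -/
theorem continuous_antisym {m : ℕ} {q : ℝ → (Fin m → Γ) → ℂ} (hq : ∀ Y, Continuous fun s => q s Y)
    (X : Fin m → Γ) : Continuous fun s => antisym (q s) X := by
  simp only [antisym, Complex.real_smul]
  exact continuous_const.mul (continuous_finsetSum _ fun π _ => continuous_const.mul (hq _))

omit [LinearOrder Γ] in
/-- The Wick coefficients vanish at strings with a repeated leg (total antisymmetry, render p0012:L17-L22).
[cite: Salmhofer1998, §3.2 (render p0012:L17-L22)] -/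
theorem wickKernel_eq_zero_of_not_injective [DecidableEq Γ] (D : Matrix Γ Γ ℂ) (F : GrassmannAlgebra ℂ Γ) {m : ℕ}
    {X : Fin m → Γ} (hX : ¬Function.Injective X) : wickKernel ℂ D F m X = 0 := by
  obtain ⟨a, b, hab, hne⟩ : ∃ a b, X a = X b ∧ a ≠ b := by
    unfold Function.Injective at hX
    push Not at hX
    exact hX
  have hfix : X ∘ Equiv.swap a b = X := by
    funext k
    simp only [Function.comp_apply]
    rcases eq_or_ne k a with rfl | hka
    · rw [Equiv.swap_apply_left, hab]
    · rcases eq_or_ne k b with rfl | hkb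
      · rw [Equiv.swap_apply_right, hab]
      · rw [Equiv.swap_apply_of_ne_of_ne hka hkb]
  have h := kernel_comp_perm ℂ (gaussConv ℂ D F) m X (Equiv.swap a b)
  rw [hfix, Equiv.Perm.sign_swap hne, Units.val_neg, Units.val_one, Int.cast_neg, Int.cast_one, neg_one_mul] at h
  rw [wickKernel_def]
  exact self_eq_neg.mp h

omit [LinearOrder Γ] in
/-- **(3.20) in every degree** (the F-078 discharge states it for `m ≤ |Γ|`; above `|Γ|` every string has a repeated leg and
both sides vanish). [cite: Salmhofer1998, §3.2 (render p0012:L108-L122)] -/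
theorem wickKernel_bilinear_eq_antisym_wickReorderKernel' [DecidableEq Γ] (D Ddot : Matrix Γ Γ ℂ)
    (hD : D.transpose = -D) (mbar : ℕ → ℕ) (𝒢 : ℕ → GrassmannAlgebra ℂ Γ) (heven : ∀ r, 𝒢 r ∈ evenOdd ℂ 0)
    (hvan : ∀ (r m : ℕ) (X : Fin m → Γ), mbar r < m → wickKernel ℂ D (𝒢 r) m X = 0) (r m : ℕ) (X : Fin m → Γ) :
    wickKernel ℂ D (∑ r₁ ∈ Finset.Icc 1 (r - 1), grassmannDerivPairing ℂ (-Ddot) (𝒢 r₁) (𝒢 (r - r₁))) m X =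
      antisym (wickReorderKernel wickReorderSign mbar D Ddot (fun r' m' => wickKernel ℂ D (𝒢 r') m') m r) X := by
  by_cases hm : m ≤ Fintype.card Γ
  · exact wickKernel_bilinear_eq_antisym_wickReorderKernel Γ D Ddot hD mbar 𝒢 heven hvan r m hm X
  · have hX : ¬Function.Injective X := fun hinj =>
      hm (by simpa using Fintype.card_le_of_injective X hinj)
    rw [wickKernel_eq_zero_of_not_injective D _ hX, antisym_eq_zero_of_not_injective _ hX]

/-- **The component RGE in F7b's typed form, from the RGE at order `λ^r`.**  Let `Γ` be finite, `t ↦ C_t` an entrywise `C¹`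
flow of covariances with derivative `Ċ_t` and a matrix `C_∞` such that every `C_∞ - C_t` is antisymmetric (print:
`D_t = C - C_t`, "`C_t` antisymmetric, continuously differentiable in `t`", render p0011:L23-L33, p0011:L159-L161), and let
`(𝒢_r(t))_{r ≥ 1}` be even elements solving Salmhofer's RGE ORDER BY ORDER in `λ` in the tree's conventions — (RGE) render
p0011:L88-L93 with the expansion (3.?) `𝒢 = Σ_r λ^r 𝒢_r` (render p0011:L146-L148) and the order-`r` bilinear term
`𝒬_r = Σ_{r₁+r₂=r}(δ𝒢_{r₁}/δψ, Ċ_t δ𝒢_{r₂}/δψ)_Γ` of (3.?) `\toWm`/(3.16) (render p0012:L41-L54) inserted, i.e.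
`∂_t 𝒢_r = Δ_{Ċ_t} 𝒢_r + ½ Σ_{r₁=1}^{r-1} (δ𝒢_{r₁}/δψ, Ċ_t δ𝒢_{r-r₁}/δψ)_Γ` coefficientwise (F7x `HasCoeffDerivAt`,
the shape of `hasCoeffDerivAt_salmhofer_rge`) — whose Wick-ordered coefficients w.r.t. `C_∞ - C_t` vanish above degree
`m̄(r)`.  Then Salmhofer's `∫dX`-weighted Wick coefficients (the tree's `weightedKernel ε` of the Wick carrier `e^{Δ_{C_∞-C_t}}𝒢_r`,
i.e. `ε^{-m} · wickKernel`), taken with a global sign, `G_{m,r}(t|X) := -ε^{-m} · wickKernel_{C_∞-C_t}(𝒢_r(t))_m(X)`, solve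
F7b's integral equation `IsRGESolution ε m̄ D Ḋ G` (typed from (3.?) `\icomRGE`, render p0012:L152-L160, with the bilinear
term `quadTerm` = (4.3), render p0014:L44-L52) for the pair `(D_t, Ḋ_t) := (C_t - C_∞, Ċ_t)` — a consistent pair
(`Ḋ = ∂_t D`, as F7b's Theorems 1–2 require).  DICTIONARY (why `-` twice): `quadTerm` encodes (4.3)'s "`+∂_t det` for every
`i`", whereas in the tree's conventions the Wick reordering of `𝒬_r` w.r.t. `C_∞ - C_t` carries the kernel-certified sign
`σ(i) = (-1)^{i-1}` (`wickReorderingFormula_wickReorderSign`, F-078); the `i`-term of (4.3) has degree `i - 1` in `D`, one in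
`Ḋ` and two in `G`, so `(D, Ḋ, G) ↦ (-D, -Ḋ, -G)` converts one orientation into the other (`quadTerm_eq_neg_wickReorderKernel`).
Proof = Salmhofer's §3.2: (3.15) (F7af `hasDerivAt_wickKernel_of_add`), (3.20) (F-078 discharge), (4.2) ⇒ (4.3)
(`pairKernel_succ_eq_sq_mul`), and `∫_0^t` (render p0012:L152-L158).  NOT proved here: that the `λ^r`-coefficients of the
effective action `log ∫dμ_{C_t} e^{λV(·+ψ)}` ((3.3)) satisfy this order-by-order system ("insert the formal power series and
compare coefficients") and Lemma 3 (ih1) (the degree bound `m̄(r) = 2r+2` propagates) — they are the hypotheses `hflow`, `hdeg`.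
[cite: Salmhofer1998, §3.1 Proposition 1 (RGE) (render p0011:L62-L93); §3.2 (3.13)-(3.17), Proposition 2, "comparison of the coefficients" (render p0012:L1-L122); §3.3 `\icomRGE` (render p0012:L152-L160); §4.1 (4.2)-(4.3) (render p0014:L17-L52)] -/
theorem isRGESolution_of_orderwise_rge
    (C : ℝ → Matrix Γ Γ ℂ) (Cdot : ℝ → Matrix Γ Γ ℂ) (Cinf : Matrix Γ Γ ℂ)
    (hC : ∀ (t : ℝ) (X Y : Γ), HasDerivAt (fun s => C s X Y) (Cdot t X Y) t)
    (hCdot : ∀ X Y : Γ, Continuous fun t => Cdot t X Y)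
    (hanti : ∀ t : ℝ, (Cinf - C t).transpose = -(Cinf - C t))
    (mbar : ℕ → ℕ) (𝒢 : ℕ → ℝ → GrassmannAlgebra ℂ Γ) (heven : ∀ (r : ℕ) (t : ℝ), 𝒢 r t ∈ evenOdd ℂ 0)
    (hflow : ∀ (r : ℕ) (t : ℝ), GrassmannAlgebra.HasCoeffDerivAt (𝒢 r)
      (grassmannLaplacian ℂ (Cdot t) (𝒢 r t) +
        (2 : ℂ)⁻¹ • ∑ r₁ ∈ Finset.Icc 1 (r - 1), grassmannDerivPairing ℂ (Cdot t) (𝒢 r₁ t) (𝒢 (r - r₁) t)) t)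
    (hdeg : ∀ (r : ℕ) (t : ℝ) (m : ℕ) (X : Fin m → Γ), mbar r < m → wickKernel ℂ (Cinf - C t) (𝒢 r t) m X = 0)
    {ε : ℝ} (hε : ε ≠ 0) :
    IsRGESolution ε mbar (fun t => C t - Cinf) Cdot
      (fun m r t X => -((ε⁻¹ ^ m : ℝ) : ℂ) * wickKernel ℂ (Cinf - C t) (𝒢 r t) m X) := by
  set G' : KernelFamily Γ := fun m r t X => -((ε⁻¹ ^ m : ℝ) : ℂ) * wickKernel ℂ (Cinf - C t) (𝒢 r t) m X with hG'
  -- (a) the family is totally antisymmetric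
  have hG'anti : ∀ (k r : ℕ) (t : ℝ) (σ : Equiv.Perm (Fin k)) (Y : Fin k → Γ),
      G' k r t (Y ∘ σ) = ((Equiv.Perm.sign σ : ℤ) : ℂ) * G' k r t Y := by
    intro k r t σ Y
    simp only [hG', wickKernel_def, kernel_comp_perm]
    ring
  -- (b) (3.15) + (3.20): the derivative of the unweighted Wick coefficients
  have hderiv0 : ∀ (m r : ℕ) (X : Fin m → Γ) (s : ℝ),
      HasDerivAt (fun u => wickKernel ℂ (Cinf - C u) (𝒢 r u) m X)
        ((2 : ℂ)⁻¹ * antisym (wickReorderKernel wickReorderSign mbar (Cinf - C s) (-(Cdot s))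
          (fun r' m' => wickKernel ℂ (Cinf - C s) (𝒢 r' s) m') m r) X) s := by
    intro m r X s
    refine (hasDerivAt_wickKernel_of_add Cinf (hC s) (hflow r s) m X).congr_deriv ?_
    rw [wickKernel_smul]
    congr 1
    have h320 := wickKernel_bilinear_eq_antisym_wickReorderKernel' (Cinf - C s) (-(Cdot s)) (hanti s) mbar
      (fun r' => 𝒢 r' s) (fun r' => heven r' s) (fun r' k Y hk => hdeg r' s k Y hk) r m X
    rw [neg_neg] at h320
    exact h320
  -- (c) the dictionary: the derivative of the weighted, negated family is `½ 𝔸_m` of F7b's `quadTerm`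
  have hεε : ∀ k : ℕ, ((ε ^ k : ℝ) : ℂ) * ((ε⁻¹ ^ k : ℝ) : ℂ) = 1 := by
    intro k
    rw [← Complex.ofReal_mul, ← mul_pow, mul_inv_cancel₀ hε, one_pow, Complex.ofReal_one]
  have hq : ∀ (m r : ℕ) (s : ℝ), quadTerm ε mbar (fun t => C t - Cinf) Cdot G' G' m r s =
      fun Y => -((ε⁻¹ ^ m : ℝ) : ℂ) * wickReorderKernel wickReorderSign mbar (Cinf - C s) (-(Cdot s))
        (fun r' m' => wickKernel ℂ (Cinf - C s) (𝒢 r' s) m') m r Y := by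
    intro m r s
    funext Y
    rw [quadTerm_eq_neg_wickReorderKernel hε mbar _ _ G' hG'anti m r s Y]
    have hfam : (fun (r' k : ℕ) (Y' : Fin k → Γ) => -((ε ^ k : ℝ) : ℂ) * G' k r' s Y') =
        fun r' m' => wickKernel ℂ (Cinf - C s) (𝒢 r' s) m' := by
      funext r' k Y'
      simp only [hG']
      rw [← mul_assoc, neg_mul_neg, hεε, one_mul]
    rw [hfam]
    congr 2
    exact neg_sub (C s) Cinf
  have hderiv : ∀ (m r : ℕ) (X : Fin m → Γ) (s : ℝ),
      HasDerivAt (fun u => G' m r u X)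
        ((2 : ℂ)⁻¹ * antisym (quadTerm ε mbar (fun t => C t - Cinf) Cdot G' G' m r s) X) s := by
    intro m r X s
    refine ((hderiv0 m r X s).const_mul (-((ε⁻¹ ^ m : ℝ) : ℂ))).congr_deriv ?_
    rw [hq, antisym_const_mul]
    ring
  -- (d) continuity of the right-hand side and the fundamental theorem of calculus
  have hcontC : ∀ X Y : Γ, Continuous fun t => (C t - Cinf) X Y := by
    intro X Y
    have h : Continuous fun t => C t X Y := continuous_iff_continuousAt.2 fun t => (hC t X Y).continuousAt
    show Continuous fun t => C t X Y - Cinf X Y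
    exact h.sub continuous_const
  have hcontG : ∀ (k r : ℕ) (Y : Fin k → Γ), Continuous fun t => G' k r t Y := fun k r Y =>
    continuous_iff_continuousAt.2 fun t => (hderiv k r Y t).continuousAt
  have hcontQ : ∀ (m r : ℕ) (Y : Fin m → Γ),
      Continuous fun s => quadTerm ε mbar (fun t => C t - Cinf) Cdot G' G' m r s Y := fun m r Y =>
    continuous_quadTerm ε mbar hcontC hCdot hcontG hcontG m r Y
  intro m r t _ X
  have hFTC := intervalIntegral.integral_eq_sub_of_hasDerivAt (a := 0) (b := t) (fun s _ => hderiv m r X s)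
    ((continuous_const.mul (continuous_antisym (hcontQ m r) X)).intervalIntegrable 0 t)
  rw [← integral_antisym _ (hcontQ m r) X 0 t, ← intervalIntegral.integral_const_mul, hFTC]
  ring

/-- **The same bridge in the sign convention of the tree's `effAction`** (`𝒱 = -𝒢 + const`, F7x
`hasCoeffDerivAt_effAction_flow`: `∂_t𝒱 = Δ_{Ċ}𝒱 - ½(δ𝒱/δψ, Ċ δ𝒱/δψ) - …`): if even elements `𝒱_r(t)` solve
`∂_t 𝒱_r = Δ_{Ċ_t} 𝒱_r - ½ Σ_{r₁=1}^{r-1} (δ𝒱_{r₁}/δψ, Ċ_t δ𝒱_{r-r₁}/δψ)_Γ` order by order, then their `∫dX`-weighted Wick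
coefficients `+ε^{-m} · wickKernel_{C_∞-C_t}(𝒱_r(t))_m` solve `IsRGESolution ε m̄ (C - C_∞) Ċ` (print's initial condition
`G_{mr}(0|X) = -δ_{r1} V_m(X)`, render p0012:L160-L162, is this orientation: `𝒢_1(0) = -V`).
[cite: Salmhofer1998, §3.1 (RGE) (render p0011:L88-L93); §3.3 `\icomRGE` (render p0012:L152-L162)] -/
theorem isRGESolution_of_orderwise_rge_neg
    (C : ℝ → Matrix Γ Γ ℂ) (Cdot : ℝ → Matrix Γ Γ ℂ) (Cinf : Matrix Γ Γ ℂ)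
    (hC : ∀ (t : ℝ) (X Y : Γ), HasDerivAt (fun s => C s X Y) (Cdot t X Y) t)
    (hCdot : ∀ X Y : Γ, Continuous fun t => Cdot t X Y)
    (hanti : ∀ t : ℝ, (Cinf - C t).transpose = -(Cinf - C t))
    (mbar : ℕ → ℕ) (𝒱 : ℕ → ℝ → GrassmannAlgebra ℂ Γ) (heven : ∀ (r : ℕ) (t : ℝ), 𝒱 r t ∈ evenOdd ℂ 0)
    (hflow : ∀ (r : ℕ) (t : ℝ), GrassmannAlgebra.HasCoeffDerivAt (𝒱 r)
      (grassmannLaplacian ℂ (Cdot t) (𝒱 r t) -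
        (2 : ℂ)⁻¹ • ∑ r₁ ∈ Finset.Icc 1 (r - 1), grassmannDerivPairing ℂ (Cdot t) (𝒱 r₁ t) (𝒱 (r - r₁) t)) t)
    (hdeg : ∀ (r : ℕ) (t : ℝ) (m : ℕ) (X : Fin m → Γ), mbar r < m → wickKernel ℂ (Cinf - C t) (𝒱 r t) m X = 0)
    {ε : ℝ} (hε : ε ≠ 0) :
    IsRGESolution ε mbar (fun t => C t - Cinf) Cdot
      (fun m r t X => ((ε⁻¹ ^ m : ℝ) : ℂ) * wickKernel ℂ (Cinf - C t) (𝒱 r t) m X) := by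
  have hwneg : ∀ (D : Matrix Γ Γ ℂ) (F : GrassmannAlgebra ℂ Γ) (m : ℕ) (X : Fin m → Γ),
      wickKernel ℂ D (-F) m X = -wickKernel ℂ D F m X := by
    intro D F m X
    rw [← neg_one_smul ℂ F, wickKernel_smul, neg_one_mul]
  have hflow' : ∀ (r : ℕ) (t : ℝ), GrassmannAlgebra.HasCoeffDerivAt (fun s => -𝒱 r s)
      (grassmannLaplacian ℂ (Cdot t) (-𝒱 r t) +
        (2 : ℂ)⁻¹ • ∑ r₁ ∈ Finset.Icc 1 (r - 1), grassmannDerivPairing ℂ (Cdot t) (-𝒱 r₁ t) (-𝒱 (r - r₁) t)) t := by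
    intro r t
    refine (hflow r t).neg.congr_deriv ?_
    simp only [map_neg, grassmannDerivPairing_neg_neg, neg_sub]
    abel
  have h := isRGESolution_of_orderwise_rge C Cdot Cinf hC hCdot hanti mbar (fun r t => -𝒱 r t)
    (fun r t => neg_mem (heven r t)) hflow' (fun r t m X hm => by rw [hwneg, hdeg r t m X hm, neg_zero]) hε
  have hfam : (fun (m r : ℕ) (t : ℝ) (X : Fin m → Γ) => -((ε⁻¹ ^ m : ℝ) : ℂ) * wickKernel ℂ (Cinf - C t) (-𝒱 r t) m X) =
      fun m r t X => ((ε⁻¹ ^ m : ℝ) : ℂ) * wickKernel ℂ (Cinf - C t) (𝒱 r t) m X := by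
    funext m r t X
    rw [hwneg]
    ring
  rw [hfam] at h
  exact h

omit [LinearOrder Γ] [Fintype Γ] in
/-- The pair fed to F7b is consistent: `∂_t (C_t - C_∞) = Ċ_t` entrywise — the hypothesis
`∀ t X X', HasDerivAt (D · X X') (Ḋ t X X') t` of F7b's Theorems 1–2 (`TruncatedPowerCounting`,
`ManyFermionGreenFunctionBound`) for `(D, Ḋ) = (C - C_∞, Ċ)`. [cite: Salmhofer1998, §3.2 `Ḋ_t = ∂_t D_t = -Ċ_t` (render p0011:L159-L161); Theorem 1 (render p0015:L12-L47)] -/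
theorem hasDerivAt_sub_const_apply (C : ℝ → Matrix Γ Γ ℂ) (Cdot : ℝ → Matrix Γ Γ ℂ) (Cinf : Matrix Γ Γ ℂ)
    (hC : ∀ (t : ℝ) (X Y : Γ), HasDerivAt (fun s => C s X Y) (Cdot t X Y) t) (t : ℝ) (X Y : Γ) :
    HasDerivAt (fun s => (C s - Cinf) X Y) (Cdot t X Y) t := by
  simpa only [Matrix.sub_apply] using (hC t X Y).sub_const (Cinf X Y)

end Flow

end Salmhofer1998

end Literature.MathematicalPhysics.QuantumLattice.FermiRG
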